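import Literature.AlgebraicGeometry.Resolution.AlterationsStableModel
import Literature.AlgebraicGeometry.Resolution.AlterationsDimension
import HarnessLib

/-!
# De Jong's alteration theorem: 4.18–4.22a split where `β : 𝒞 → X` has become a morphism (4.22)

Topic: `Literature/AlgebraicGeometry/Resolution`. Companion to `AlterationsStableModel.lean`,
which cuts de Jong 1996, 4.17–4.22a at 4.17 into the named facts
`DeJong1996StableModelReduction` (4.17: reaching (vi) g), `DeJong1996.IsUnionOfSectionsWithModel`)
and `DeJong1996StableModelToPreSemiStablePair` (4.18–4.21 with 4.22 up to the induction
hypothesis: from a fibred pair with (vi) e), f), g) to all pre-semi-stable pairs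
`DeJong1996.PreSemiStablePair` of the same dimension). The printed 4.22 begins

> "4.22. We continue the discussion of the proof of Theorem 4.1, from the point we left it in
> the beginning of 4.18. Thus we have a pair `(X, Z)` satisfying (i)–(iv), (vi) a)–g). We apply
> the results of 4.18–4.21 and find a modification `ψ : Y' → Y`, such that `β'` extends. Once
> again using 4.15 we may replace `Y` by `Y'`, etc., and assume that `β` extends to `β : 𝒞 → X`
> and we still have (i)–(iv), (vi) a)–g). Consider the closed subset `β⁻¹(Z)`, which is pure
> of codimension 1 in `𝒞` by (iv). Let `E'` be an irreducible component of `β⁻¹(Z)`. If we do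
> not have `E' = τᵢ(Y)` for some `i`, then the image `D'` of `E'` in `Y` has codimension 1 in
> `Y`, as `β` is an isomorphism over the open set `U` of (vi) g). Thus there is a closed subset
> `D ⊂ Y` such that we have `β⁻¹(Z) ⊂ τ₁(Y) ∪ … ∪ τₙ(Y) ∪ f⁻¹(D)` and such that `𝒞 → Y` is
> smooth over `Y ∖ D`. We replace `X` by `𝒞` and `Z` by `τ₁(Y) ∪ … ∪ τₙ(Y) ∪ f⁻¹(D)`, see 4.4
> and 4.9." (p. 74)

This file cuts `DeJong1996StableModelToPreSemiStablePair` once more, at "and assume that `β`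
extends to `β : 𝒞 → X` and we still have (i)–(iv), (vi) a)–g)", and PROVES everything after the
cut:

* `DeJong1996.StableModelMorphism f g Z σ fC τ β` — **the situation of 4.22 once `β` is a
  morphism**: `(X, Z)` a fibred pair over `Y` with (vi) e) and (vi) f) `Z = ⋃ σᵢ(Y)`; the model
  `(fC : 𝒞 → Y, τ₁, …, τₙ)` of (vi) g), a pointed semi-stable curve
  (`DeJong1996.IsPointedSemiStableCurve`, the rendering of "stable `n`-pointed" fixed in
  `AlterationsStableModel.lean`) with `𝒞` integral and projective over `k` (as in
  `DeJong1996.HasPointedSemiStableModel`); and the `Y`-morphism `β : 𝒞 → X` (`β ≫ f = fC`)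
  "mapping the section `τᵢ` to the section `σᵢ`" (`τᵢ ≫ β = σᵢ`), an isomorphism over a
  non-empty open `U ⊆ Y` over which `f` is smooth (4.17: "`U = {y ∈ Y | X_y` is smooth over `y`
  and `σᵢ(y) ≠ σⱼ(y)` for `i ≠ j}`"); proved: such a situation has (vi) f) + g)
  (`StableModelMorphism.isUnionOfSectionsWithModel`: restrict `β` over `U`);
* PROVED, **4.22 from "Consider the closed subset `β⁻¹(Z)`" to "see 4.4 and 4.9"**
  (`DeJong1996.StableModelMorphism.conclusionGenericallyEtale_of_preSemiStablePair`): Thm. 4.1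
  with its generically-étale clause for `(X → Spec k, Z)` follows from the same for all
  pre-semi-stable pairs over `k` of dimension `dim X`. With `D = Y ∖ U`: `(𝒞 → Y, D, τ)` is a
  pre-semi-stable pair (`StableModelMorphism.preSemiStablePair`; `𝒞 → Y` is smooth over `U`
  because there it is `𝒞_U ≅ X_U → U`); `β⁻¹(Z) ⊆ ⋃ᵢ τᵢ(Y) ∪ fC⁻¹(D)`
  (`preimage_subset_semiStableBoundary`: a point of `β⁻¹(σᵢ(Y))` over `y ∈ U` is `τᵢ(y)`, `β`
  being injective over `U`); `β⁻¹(Z)` is the support of the effective Cartier divisor pulled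
  back from the divisor of (iv) (`exists_isEffectiveCartier_preimage`, 4.10), so 4.9
  (`ConclusionGenericallyEtale.of_subset`) enlarges `β⁻¹(Z)` to the boundary; and `β` is a
  generically étale alteration (`isAlteration`, `isGenericallyEtale`: proper since `𝒞 → Y` is
  proper and `X → Y` separated, dominant and an isomorphism over the non-empty open `f⁻¹(U)`) of
  the same dimension (2.20, `IsAlteration.topologicalKrullDim_eq`), so 4.4
  (`ConclusionGenericallyEtale.of_isAlteration`) descends the conclusion to `(X, Z)`;
* `DeJong1996StableModelToMorphism` — NAMED FACT, **4.18–4.21 and 4.22 up to "we still have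
  (i)–(iv), (vi) a)–g)"**: Thm. 4.1 with its generically-étale clause for a fibred pair with
  (vi) e), f), g) (`DeJong1996.IsUnionOfSectionsWithModel`) follows from the same for all
  situations `StableModelMorphism` over `k` of the same dimension (the three-point lemma
  4.18–4.21: flattening 2.19, Lemma 4.20, Serre's criterion; then 4.15 along the modification
  `ψ` and 4.4);
* PROVED: `DeJong1996StableModelToPreSemiStablePair.of_stableModelToMorphism` — the node
  4.18–4.22a of `AlterationsStableModel.lean` follows from `DeJong1996StableModelToMorphism` —
  and the composites through the assemblies of `AlterationsStableModel.lean`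
  (`DeJong1996SectionsToPreSemiStablePair`, `DeJong1996MultisectionToPreSemiStablePair`,
  `DeJong1996StrongAlgClosed`, `DeJong1996Strong`); sanity implication from
  `DeJong1996StrongAlgClosed`.

So the live named inputs below `DeJong1996SectionsToPreSemiStablePair` are
`DeJong1996StableModelReduction` (4.17) and `DeJong1996StableModelToMorphism` (4.18–4.21 with the
opening of 4.22); the latter is the node to decompose further (the three-point lemma in the
general setting of 4.18; 4.15 along a modification, with the transport of (vi) f), g)). The
owning literature unit's `NOTES.md` keeps the DAG.

## Sources

* A. J. de Jong, *Smoothness, semi-stability and alterations*, Publ. Math. IHÉS 83 (1996) 51–93: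
  2.19–2.21, 2.24 (pp. 60–62), Thm. 4.1, 4.4, 4.9, 4.10 (pp. 66–67), 4.15–4.17 (pp. 71–72),
  4.18–4.22 (pp. 72–74), 4.23 (p. 75).
-/

noncomputable section

open CategoryTheory CategoryTheory.Limits AlgebraicGeometry TopologicalSpace Topology

namespace Literature.AlgebraicGeometry.Resolution

universe u

/-- A morphism which is an isomorphism over an open `V` of the target has `V` in its image.
[folklore] -/
theorem subset_range_of_isIso_morphismRestrict {C X : Scheme.{u}} (β : C ⟶ X) (V : X.Opens)
    [IsIso (β ∣_ V)] : ((V : X.Opens) : Set X) ⊆ Set.range β := by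
  intro x hx
  obtain ⟨c, hc⟩ := (Scheme.homeoOfIso (asIso (β ∣_ V))).surjective ⟨x, hx⟩
  refine ⟨c.1, ?_⟩
  have := congr_arg Subtype.val hc
  rw [Scheme.coe_homeoOfIso, asIso_hom, morphismRestrict_base_coe] at this
  exact this

namespace DeJong1996

/-! ## The situation of 4.22 once `β` is a morphism -/

/-- **de Jong 1996, 4.22: "assume that `β` extends to `β : 𝒞 → X` and we still have (i)–(iv),
(vi) a)–g)"** — the data at the point of 4.22 where the analysis of `β⁻¹(Z)` starts, over the
ambient field `k`. The pair `(X, Z)` with its fibration `f : X → Y → Spec k` satisfies (i),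
(iii), (iv), (vi) a)–d) (`FibredPair f g Z`), (vi) e) (`HasThreeSmoothPoints f Z`) and (vi) f)
"There are sections `σᵢ : Y → X`, `i = 1, …, n` of `f` such that `Z = ⋃ σᵢ(Y)`". Of (vi) g)
"There exist a stable `n`-pointed curve `(𝒞, τ₁, …, τₙ)` over `Y`, a nonempty open subscheme
`U ⊂ Y` and an isomorphism `β : 𝒞_U → X_U` mapping the section `τᵢ|_U` to the section `σᵢ|_U`"
we record, as in `HasPointedSemiStableModel`: `(fC : 𝒞 → Y, τ)` is a pointed semi-stable curve
(`IsPointedSemiStableCurve`: 2.21 with mutually disjoint sections into the smooth locus; "We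
drop the stability hypothesis, since we will not need it any more", 4.22) and `𝒞` is integral
(4.18, 4.21) and projective over `k` (2.24, 2.19: hypothesis (iii) for the pair `(𝒞, …)`
replacing `(X, Z)`); and `β` has extended to a `Y`-morphism `β : 𝒞 → X` (`β ≫ f = fC`) with
`τᵢ ≫ β = σᵢ`, which is an isomorphism `𝒞_U → X_U` over a non-empty open `U ⊆ Y`
(`IsIso (β ∣_ f⁻¹(U))`) contained in the locus over which `f` is smooth (4.17: "`U = {y ∈ Y |
X_y` is smooth over `y` and `σᵢ(y) ≠ σⱼ(y)` for `i ≠ j}`"; both properties of `U` survive the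
base changes `U' = ψ⁻¹(U)` of 4.15). [cite: DeJong1996, 4.17 (vi) g) and 4.22, pp. 72–74] -/
structure StableModelMorphism {k : Type u} [Field k] {X Y C : Scheme.{u}} [IsIntegral Y]
    (f : X ⟶ Y) [LocallyOfFinitePresentation f] (g : Y ⟶ Spec (.of k)) (Z : Set X) {n : ℕ}
    (σ : Fin n → (Y ⟶ X)) (fC : C ⟶ Y) (τ : Fin n → (Y ⟶ C)) (β : C ⟶ X) : Prop where
  /-- (i), (iii), (iv), (vi) a)–d) for `(X, Z)` and `f : X → Y → Spec k` -/
  fibredPair : FibredPair f g Z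
  /-- (vi) e) -/
  hasThreeSmoothPoints : HasThreeSmoothPoints f Z
  /-- (vi) f): the `σᵢ` are sections of `f` … -/
  σ_comp : ∀ i, σ i ≫ f = 𝟙 Y
  /-- … and `Z = ⋃ᵢ σᵢ(Y)` -/
  eq_iUnion_range : Z = ⋃ i, Set.range (σ i)
  /-- `𝒞` is integral -/
  isIntegral : IsIntegral C
  /-- `𝒞` is projective over `k` -/
  isProjectiveOver : Literature.AlgebraicGeometry.Motives.IsProjectiveOver (Over.mk (fC ≫ g))
  /-- `(fC : 𝒞 → Y, τ₁, …, τₙ)` is a pointed semi-stable curve -/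
  isPointedSemiStableCurve : IsPointedSemiStableCurve fC τ
  /-- `β` is a `Y`-morphism -/
  comp_eq : β ≫ f = fC
  /-- `β` maps the section `τᵢ` to the section `σᵢ` -/
  τ_comp : ∀ i, τ i ≫ β = σ i
  /-- `β` is an isomorphism `𝒞_U → X_U` over a non-empty open `U ⊆ Y` over which `f` is
  smooth -/
  exists_isIso : ∃ U : Y.Opens, (U : Set Y).Nonempty ∧ Smooth (f ∣_ U) ∧ IsIso (β ∣_ (f ⁻¹ᵁ U))

namespace StableModelMorphism

variable {k : Type u} [Field k] {X Y C : Scheme.{u}} [IsIntegral Y] {f : X ⟶ Y}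
  [LocallyOfFinitePresentation f] {g : Y ⟶ Spec (.of k)} {Z : Set X} {n : ℕ}
  {σ : Fin n → (Y ⟶ X)} {fC : C ⟶ Y} {τ : Fin n → (Y ⟶ C)} {β : C ⟶ X}

/-- `fC : 𝒞 → Y` is a semi-stable curve. [folklore] -/
theorem isSemiStableCurve (h : StableModelMorphism f g Z σ fC τ β) : IsSemiStableCurve fC :=
  h.isPointedSemiStableCurve.isSemiStableCurve

/-- The `τᵢ` are sections of `fC`. [folklore] -/
theorem comp_eq_id (h : StableModelMorphism f g Z σ fC τ β) (i : Fin n) : τ i ≫ fC = 𝟙 Y :=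
  h.isPointedSemiStableCurve.comp_eq_id i

/-- `f : X → Y` is separated (`X → Spec k` is). [folklore] -/
theorem isSeparated (h : StableModelMorphism f g Z σ fC τ β) : IsSeparated f :=
  haveI := h.fibredPair.isSeparated
  IsSeparated.of_comp f g

/-- `β : 𝒞 → X` is proper: `β ≫ f = fC` is proper and `f` is separated. [folklore] -/
theorem isProper (h : StableModelMorphism f g Z σ fC τ β) : IsProper β := by
  haveI := h.isSeparated
  haveI : IsProper (β ≫ f) := by
    rw [h.comp_eq]
    exact h.isSemiStableCurve.isProper
  exact IsProper.of_comp β f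

/-- `fC : 𝒞 → Y` is surjective (a semi-stable curve with non-empty source over an irreducible
base is dominant and closed). [folklore] -/
theorem surjective_fC (h : StableModelMorphism f g Z σ fC τ β) : Surjective fC := by
  haveI := h.isIntegral
  haveI := h.isSemiStableCurve.isDominant
  haveI := h.isSemiStableCurve.isProper
  exact surjective_of_isDominant_of_isClosed_range fC fC.isClosedMap.isClosed_range

/-- The preimage in `X` of a non-empty subset of `Y` is non-empty ((vi) a): `f` is onto).
[folklore] -/
theorem preimage_nonempty (h : StableModelMorphism f g Z σ fC τ β) {U : Set Y}
    (hU : U.Nonempty) : (f ⁻¹' U).Nonempty := by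
  haveI := h.fibredPair.isCurveFibration.surjective
  obtain ⟨y, hy⟩ := hU
  obtain ⟨x, rfl⟩ := f.surjective y
  exact ⟨x, hy⟩

/-- The preimage in `𝒞` of a non-empty subset of `Y` is non-empty. [folklore] -/
theorem preimage_fC_nonempty (h : StableModelMorphism f g Z σ fC τ β) {U : Set Y}
    (hU : U.Nonempty) : (fC ⁻¹' U).Nonempty := by
  haveI := h.surjective_fC
  obtain ⟨y, hy⟩ := hU
  obtain ⟨x, rfl⟩ := fC.surjective y
  exact ⟨x, hy⟩

/-- `β⁻¹(f⁻¹(U)) = fC⁻¹(U)`. [folklore] -/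
theorem preimage_preimage_eq (h : StableModelMorphism f g Z σ fC τ β) (U : Y.Opens) :
    β ⁻¹ᵁ (f ⁻¹ᵁ U) = fC ⁻¹ᵁ U := by
  rw [← h.comp_eq]
  rfl

/-- Over the open `U` of (vi) g), `β` is onto `f⁻¹(U)`. [folklore] -/
theorem subset_range (_h : StableModelMorphism f g Z σ fC τ β) {U : Y.Opens}
    (hiso : IsIso (β ∣_ (f ⁻¹ᵁ U))) : ((f ⁻¹ᵁ U : X.Opens) : Set X) ⊆ Set.range β :=
  subset_range_of_isIso_morphismRestrict β (f ⁻¹ᵁ U)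

/-- Over the open `U` of (vi) g), `β` is injective. [folklore] -/
theorem injOn (h : StableModelMorphism f g Z σ fC τ β) {U : Y.Opens}
    (hiso : IsIso (β ∣_ (f ⁻¹ᵁ U))) : Set.InjOn β ((fC ⁻¹ᵁ U : C.Opens) : Set C) := by
  intro a ha b hb hab
  rw [← h.preimage_preimage_eq U] at ha hb
  have hinj := (β ∣_ (f ⁻¹ᵁ U)).isOpenEmbedding.injective
  have : (⟨a, ha⟩ : ↥(β ⁻¹ᵁ (f ⁻¹ᵁ U))) = ⟨b, hb⟩ := by
    apply hinj
    apply Subtype.ext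
    rw [morphismRestrict_base_coe, morphismRestrict_base_coe]
    exact hab
  exact congr_arg Subtype.val this

/-- `β` is dominant: its image contains the non-empty open `f⁻¹(U)` of the irreducible `X`.
[folklore] -/
theorem isDominant (h : StableModelMorphism f g Z σ fC τ β) : IsDominant β := by
  haveI := h.fibredPair.isIntegral
  obtain ⟨U, hU, -, hiso⟩ := h.exists_isIso
  refine ⟨?_⟩
  have hne : ((f ⁻¹ᵁ U : X.Opens) : Set X).Nonempty := h.preimage_nonempty hU
  exact ((f ⁻¹ᵁ U).isOpen.dense hne).mono (h.subset_range hiso)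

/-- **`β : 𝒞 → X` is an alteration** (2.20; indeed a modification, 2.17): `𝒞` is integral, `β`
is proper and dominant, and over the non-empty open `f⁻¹(U)` it is an isomorphism, in
particular finite. [cite: DeJong1996, 2.20, p. 61] -/
theorem isAlteration (h : StableModelMorphism f g Z σ fC τ β) : IsAlteration β := by
  obtain ⟨U, hU, -, hiso⟩ := h.exists_isIso
  haveI := hiso
  exact ⟨h.isIntegral, h.isProper, h.isDominant, f ⁻¹ᵁ U, h.preimage_nonempty hU, inferInstance⟩

/-- **`β : 𝒞 → X` is generically étale** (2.6): it is an isomorphism over `f⁻¹(U)`, whose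
preimage `fC⁻¹(U)` is a non-empty open of the irreducible `𝒞`, hence dense. [folklore] -/
theorem isGenericallyEtale (h : StableModelMorphism f g Z σ fC τ β) : IsGenericallyEtale β := by
  haveI := h.isIntegral
  obtain ⟨U, hU, -, hiso⟩ := h.exists_isIso
  haveI := hiso
  refine IsGenericallyEtale.of_isIso_morphismRestrict β (f ⁻¹ᵁ U) ?_
  rw [h.preimage_preimage_eq U]
  exact (fC ⁻¹ᵁ U).isOpen.dense (h.preimage_fC_nonempty hU)

/-- **`dim 𝒞 = dim X`** (2.20: an alteration of a variety preserves the dimension).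
[cite: DeJong1996, 2.20, p. 61] -/
theorem topologicalKrullDim_eq (h : StableModelMorphism f g Z σ fC τ β) :
    topologicalKrullDim C = topologicalKrullDim X := by
  haveI := h.fibredPair.isIntegral
  haveI := h.fibredPair.locallyOfFiniteType
  exact h.isAlteration.topologicalKrullDim_eq (f ≫ g)

/-- Over the open `U` of (vi) g), `fC : 𝒞 → Y` is smooth: there it is the composite of the
isomorphism `β : 𝒞_U → X_U` and the smooth `X_U → U`. [folklore] -/
theorem smooth_morphismRestrict (h : StableModelMorphism f g Z σ fC τ β) {U : Y.Opens}
    (hsm : Smooth (f ∣_ U)) (hiso : IsIso (β ∣_ (f ⁻¹ᵁ U))) : Smooth (fC ∣_ U) := by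
  have e := h.comp_eq
  subst e
  haveI := hsm
  haveI := hiso
  -- `(β ≫ f) ∣_ U = β ∣_ f⁻¹(U) ≫ f ∣_ U`, an isomorphism followed by a smooth morphism
  have : Smooth (β ∣_ (f ⁻¹ᵁ U) ≫ f ∣_ U) := inferInstance
  rw [← morphismRestrict_comp] at this
  exact this

/-- **The pair `(𝒞, τ₁(Y) ∪ … ∪ τₙ(Y) ∪ fC⁻¹(D))` of 4.22 with `D = Y ∖ U` is a pre-semi-stable
pair**: "there is a closed subset `D ⊂ Y` such that […] `𝒞 → Y` is smooth over `Y ∖ D`"; `D` is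
a proper closed subset since `U` is a non-empty open. [cite: DeJong1996, 4.22, p. 74] -/
theorem preSemiStablePair (h : StableModelMorphism f g Z σ fC τ β) {U : Y.Opens}
    (hU : (U : Set Y).Nonempty) (hsm : Smooth (f ∣_ U)) (hiso : IsIso (β ∣_ (f ⁻¹ᵁ U))) :
    PreSemiStablePair fC g (U : Set Y)ᶜ τ where
  isIntegral := h.isIntegral
  isProjectiveOver := h.isProjectiveOver
  isIntegral_base := ‹_›
  isProjectiveOver_base := h.fibredPair.isProjectiveOver_base
  isClosed := U.isOpen.isClosed_compl
  ne_univ := fun e => by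
    obtain ⟨y, hy⟩ := hU
    have : y ∈ (U : Set Y)ᶜ := e ▸ Set.mem_univ y
    exact this hy
  isSemiStableCurve := h.isSemiStableCurve
  smooth_morphismRestrict := by
    have key : ∀ (V : Y.Opens), V = U → Smooth (fC ∣_ V) := by
      rintro V rfl
      exact h.smooth_morphismRestrict hsm hiso
    exact key _ (TopologicalSpace.Opens.ext (compl_compl (U : Set Y)))
  comp_eq_id := h.isPointedSemiStableCurve.comp_eq_id
  pairwise_disjoint := h.isPointedSemiStableCurve.pairwise_disjoint
  exists_smooth := h.isPointedSemiStableCurve.exists_smooth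

/-- **"`β⁻¹(Z) ⊂ τ₁(Y) ∪ … ∪ τₙ(Y) ∪ f⁻¹(D)`"** with `D = Y ∖ U`: a point `x ∈ β⁻¹(σᵢ(Y))` lying
over `y ∈ U` equals `τᵢ(y)`, since both lie in `𝒞_U`, on which `β` is injective, and
`β(x) = σᵢ(y) = β(τᵢ(y))`. [cite: DeJong1996, 4.22, p. 74] -/
theorem preimage_subset_semiStableBoundary (h : StableModelMorphism f g Z σ fC τ β)
    {U : Y.Opens} (hiso : IsIso (β ∣_ (f ⁻¹ᵁ U))) :
    β ⁻¹' Z ⊆ semiStableBoundary fC (U : Set Y)ᶜ τ := by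
  intro x hx
  rw [mem_semiStableBoundary_iff]
  by_cases hxU : fC x ∈ U
  · left
    rw [Set.mem_preimage, h.eq_iUnion_range, Set.mem_iUnion] at hx
    obtain ⟨i, y, hy⟩ := hx
    refine ⟨i, fC x, ?_⟩
    -- `y = f (σᵢ y) = f (β x) = fC x`
    have hyx : y = fC x := by
      have h1 : f (σ i y) = y := by
        rw [← Scheme.Hom.comp_apply, h.σ_comp i]
        rfl
      rw [← h1, hy, ← Scheme.Hom.comp_apply, h.comp_eq]
    subst hyx
    -- both `τᵢ (fC x)` and `x` lie over `U` and have the same image under `β`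
    apply h.injOn hiso
    · show fC (τ i (fC x)) ∈ U
      rw [← Scheme.Hom.comp_apply, h.comp_eq_id i]
      exact hxU
    · exact hxU
    · rw [← Scheme.Hom.comp_apply, h.τ_comp i]
      exact hy
  · right
    exact hxU

/-- **"the closed subset `β⁻¹(Z)`, which is pure of codimension 1 in `𝒞` by (iv)"**: `β⁻¹(Z)`
is the support of the pull-back along the dominant `β` of the effective Cartier divisor of (iv)
(4.10, `IsEffectiveCartier.comap_of_isDominant`). [cite: DeJong1996, 4.10 and 4.22, pp. 67, 74] -/
theorem exists_isEffectiveCartier_preimage (h : StableModelMorphism f g Z σ fC τ β) :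
    ∃ I : C.IdealSheafData, IsEffectiveCartier I ∧ (I.support : Set C) = β ⁻¹' Z := by
  haveI := h.isIntegral
  haveI := h.fibredPair.isIntegral
  haveI := h.isDominant
  haveI := h.isProper
  obtain ⟨D, hD, hDZ⟩ := h.fibredPair.exists_isEffectiveCartier
  refine ⟨D.comap β, hD.comap_of_isDominant β, ?_⟩
  rw [Scheme.IdealSheafData.support_comap, TopologicalSpace.Closeds.coe_preimage, hDZ]

/-- **de Jong 1996, 4.22 from "Consider the closed subset `β⁻¹(Z)`" to "We replace `X` by `𝒞`
and `Z` by `τ₁(Y) ∪ … ∪ τₙ(Y) ∪ f⁻¹(D)`, see 4.4 and 4.9" — PROVED.** In the situation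
`StableModelMorphism f g Z σ fC τ β`, Thm. 4.1 with its generically-étale clause for
`(X → Spec k, Z)` follows from the same for every pre-semi-stable pair over `k`
(`PreSemiStablePair`, boundary `semiStableBoundary`) of dimension `dim X`: with `D = Y ∖ U`,
the pair `(𝒞 → Y, D, τ)` is pre-semi-stable of dimension `dim 𝒞 = dim X`; its conclusion for
the boundary `⋃ᵢ τᵢ(Y) ∪ fC⁻¹(D) ⊇ β⁻¹(Z)` gives the conclusion for `(𝒞, β⁻¹(Z))` by 4.9
(`ConclusionGenericallyEtale.of_subset`; `β⁻¹(Z)` is the support of a divisor), and then for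
`(X, Z)` by 4.4 along the generically étale alteration `β`
(`ConclusionGenericallyEtale.of_isAlteration`). [cite: DeJong1996, 4.22, p. 74] -/
theorem conclusionGenericallyEtale_of_preSemiStablePair (h : StableModelMorphism f g Z σ fC τ β)
    (H : ∀ (X' Y' : Scheme.{u}) (f' : X' ⟶ Y') (g' : Y' ⟶ Spec (.of k)) (D' : Set Y') (n' : ℕ)
        (τ' : Fin n' → (Y' ⟶ X')), PreSemiStablePair f' g' D' τ' →
        topologicalKrullDim X' = topologicalKrullDim X →
          ConclusionGenericallyEtale (f' ≫ g') (semiStableBoundary f' D' τ')) :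
    ConclusionGenericallyEtale (f ≫ g) Z := by
  haveI := h.isIntegral
  haveI := h.fibredPair.isIntegral
  obtain ⟨U, hU, hsm, hiso⟩ := h.exists_isIso
  have hpre := h.preSemiStablePair hU hsm hiso
  haveI : IsProper (fC ≫ g) := hpre.isProper
  have h₁ : ConclusionGenericallyEtale (fC ≫ g) (semiStableBoundary fC (U : Set Y)ᶜ τ) :=
    H C Y fC g (U : Set Y)ᶜ n τ hpre h.topologicalKrullDim_eq
  have h₂ : ConclusionGenericallyEtale (fC ≫ g) (β ⁻¹' Z) :=
    ConclusionGenericallyEtale.of_subset (h.preimage_subset_semiStableBoundary hiso)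
      h.exists_isEffectiveCartier_preimage h₁
  rw [← h.comp_eq, Category.assoc] at h₂
  exact ConclusionGenericallyEtale.of_isAlteration h.isAlteration h.isGenericallyEtale h₂

/-- A situation `StableModelMorphism` is in particular a fibred pair, so Thm. 4.1 with its
generically-étale clause over algebraically closed fields (`DeJong1996StrongAlgClosed`) serves it.
[folklore] -/
theorem conclusionGenericallyEtale_of_strongAlgClosed [IsAlgClosed k]
    (h : StableModelMorphism f g Z σ fC τ β) (H : DeJong1996StrongAlgClosed.{u}) :
    ConclusionGenericallyEtale (f ≫ g) Z :=
  h.fibredPair.conclusionGenericallyEtale_of_strongAlgClosed H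

/-- In the situation `StableModelMorphism`, the sections `σᵢ = τᵢ ≫ β` are pairwise distinct:
the `τᵢ(Y)` are disjoint and `β` is injective over the non-empty `U` (4.17:
`U ⊆ {y | σᵢ(y) ≠ σⱼ(y), i ≠ j}`). [folklore] -/
theorem injective (h : StableModelMorphism f g Z σ fC τ β) : Function.Injective σ := by
  obtain ⟨U, hU, -, hiso⟩ := h.exists_isIso
  intro i j hij
  by_contra hne
  obtain ⟨y, hy⟩ := hU
  have hdisj := h.isPointedSemiStableCurve.pairwise_disjoint hne
  -- `τᵢ y ≠ τⱼ y`, both over `y ∈ U`, yet `β (τᵢ y) = σᵢ y = σⱼ y = β (τⱼ y)`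
  have hτ : τ i y = τ j y := by
    apply h.injOn hiso
    · show fC (τ i y) ∈ U
      rw [← Scheme.Hom.comp_apply, h.comp_eq_id i]
      exact hy
    · show fC (τ j y) ∈ U
      rw [← Scheme.Hom.comp_apply, h.comp_eq_id j]
      exact hy
    · rw [← Scheme.Hom.comp_apply, ← Scheme.Hom.comp_apply, h.τ_comp i, h.τ_comp j, hij]
  exact Set.disjoint_iff.mp hdisj ⟨⟨y, rfl⟩, ⟨y, hτ.symm⟩⟩

/-- In the situation `StableModelMorphism`, `(X, Z)` has (vi) f) (`IsUnionOfSections`).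
[folklore] -/
theorem isUnionOfSections (h : StableModelMorphism f g Z σ fC τ β) : IsUnionOfSections f Z :=
  ⟨n, σ, h.injective, h.σ_comp, h.eq_iUnion_range⟩

/-- In the situation `StableModelMorphism`, `(𝒞, τ)` restricted over `U` is a pointed
semi-stable model of `(X, σ)` in the sense of (vi) g) (`HasPointedSemiStableModel`): the
isomorphism is `β|_{𝒞_U} : 𝒞_U = β⁻¹(f⁻¹(U)) ⥲ f⁻¹(U)`, and the corestrictions of the `τᵢ|_U`
to `𝒞_U` are carried to the `σᵢ|_U`. [cite: DeJong1996, 4.17 (vi) g), p. 72] -/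
theorem hasPointedSemiStableModel (h : StableModelMorphism f g Z σ fC τ β) :
    HasPointedSemiStableModel f g σ := by
  obtain ⟨U, hU, -, hiso⟩ := h.exists_isIso
  haveI := hiso
  -- `β` restricted over `U`, precomposed with `𝒞_U = fC⁻¹(U) ≅ β⁻¹(f⁻¹(U))`
  let e : ((fC ⁻¹ᵁ U : C.Opens) : Scheme.{u}) ≅ (β ⁻¹ᵁ (f ⁻¹ᵁ U) : C.Opens) :=
    C.isoOfEq (h.preimage_preimage_eq U).symm
  let β' : ((fC ⁻¹ᵁ U : C.Opens) : Scheme.{u}) ⟶ (f ⁻¹ᵁ U : X.Opens) :=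
    e.hom ≫ β ∣_ (f ⁻¹ᵁ U)
  have hβ' : β' ≫ (f ⁻¹ᵁ U).ι = (fC ⁻¹ᵁ U).ι ≫ β := by
    simp only [β', e, Category.assoc, morphismRestrict_ι]
    rw [← Category.assoc, Scheme.isoOfEq_hom_ι]
  refine ⟨C, fC, τ, U, β', h.isIntegral, h.isProjectiveOver, h.isPointedSemiStableCurve, hU,
    inferInstance, ?_, fun i => ?_⟩
  · rw [← Category.assoc, hβ', Category.assoc, h.comp_eq]
  · -- the corestriction of `τᵢ|_U` to `𝒞_U`
    have hsub : Set.range (U.ι ≫ τ i) ⊆ Set.range (fC ⁻¹ᵁ U).ι := by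
      rintro _ ⟨y, rfl⟩
      rw [Scheme.Opens.range_ι]
      show fC (τ i (U.ι y)) ∈ U
      rw [← Scheme.Hom.comp_apply, h.comp_eq_id i]
      exact y.2
    refine ⟨IsOpenImmersion.lift (fC ⁻¹ᵁ U).ι (U.ι ≫ τ i) hsub, IsOpenImmersion.lift_fac _ _ _,
      ?_⟩
    rw [hβ', ← Category.assoc, IsOpenImmersion.lift_fac, Category.assoc, h.τ_comp i]

/-- In the situation `StableModelMorphism`, `(X, Z)` has (vi) f) + g) with the sections `σᵢ`
(`IsUnionOfSectionsWithModel`), i.e. it is one of the pairs produced by 4.17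
(`DeJong1996StableModelReduction`). [folklore] -/
theorem isUnionOfSectionsWithModel (h : StableModelMorphism f g Z σ fC τ β) :
    IsUnionOfSectionsWithModel f g Z :=
  IsUnionOfSectionsWithModel.mk' h.injective h.σ_comp h.eq_iUnion_range h.hasPointedSemiStableModel

end StableModelMorphism

end DeJong1996

/-! ## 4.18–4.21 with the opening of 4.22 as a named fact -/

/-- NAMED FACT — **de Jong 1996, 4.18–4.21 and 4.22 up to "we still have (i)–(iv), (vi) a)–g)":
making the rational map `β : 𝒞 ⇢ X` of (vi) g) a morphism.** Over an algebraically closed field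
`k`, let `(X, Z)` with `f : X → Y → Spec k` satisfy (i), (iii), (iv), (vi) a)–d)
(`DeJong1996.FibredPair f g Z`), (vi) e) (`DeJong1996.HasThreeSmoothPoints f Z`) and (vi) f) + g)
(`DeJong1996.IsUnionOfSectionsWithModel f g Z`: `Z = ⋃ σᵢ(Y)` and a pointed semi-stable model
`(𝒞, τ)` of `(X, σ)`, integral and projective over `k`, over a non-empty open of `Y`). Then
Thm. 4.1 with its generically-étale clause for `(X → Spec k, Z)` follows from Thm. 4.1 with the
clause for every situation `DeJong1996.StableModelMorphism f' g' Z' σ' fC τ' β` over `k` (the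
same kind of data with `β : 𝒞' → X'` a `Y'`-MORPHISM, `τ'ᵢ ≫ β = σ'ᵢ`, an isomorphism over a
non-empty open of `Y'` over which `f'` is smooth) with `dim X' = dim X`. This is 4.18–4.21 in
the general setting of 4.18 ("Suppose we are given a proper morphism `f : X → S` of integral
excellent schemes, with sections `σ₁, …, σₙ` satisfying […] a) […] b) […] c) […] e) […] g)
[…]. Let us define `T` as the closure of `Γ_β` in the scheme `𝒞 ×_S X`. […] Let `S' → S` be a
modification and apply the reasoning of 4.15. […] by [22], see 2.19, we may assume […] h) Both
`X` and `T`, defined as above, are flat over `S`. […] Thus we may normalize `S` and assume that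
i) The scheme `S` is normal. […] 4.20. Lemma. […] 4.21. In the situation of 4.19, the lemma
implies that the morphism `pr₁ : T → 𝒞` has finite fibres, hence is a finite morphism. We
remark that `𝒞` is a normal scheme […]. Thus the birational finite morphism `pr₁ : T → 𝒞` is
an isomorphism. We conclude that the properties a)–c), e) and g) on data `X → S`, `σᵢ` as in
4.18 imply that the rational map `β` extends to a birational morphism `β : 𝒞 → X`, at least
after replacing `S` by a modification and `𝒞` and `X` by their strict transforms.") followed by
the opening of 4.22 ("Thus we have a pair `(X, Z)` satisfying (i)–(iv), (vi) a)–g). We apply the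
results of 4.18–4.21 and find a modification `ψ : Y' → Y`, such that `β'` extends. Once again
using 4.15 we may replace `Y` by `Y'`, etc., and assume that `β` extends to `β : 𝒞 → X` and we
still have (i)–(iv), (vi) a)–g)."). Of "stable `n`-pointed" only the nodality of the fibres of
`𝒞` and the distinctness and smoothness of the labelled points are used (4.20, Cases 1–2; 4.21),
so the printed argument proves the statement with (vi) g) as rendered; the open `U` of (vi) g)
lies in the smooth locus of `f` in the text (4.17) and this survives `U' = ψ⁻¹(U)`. The
replacement of `(X, Z)` is along the generically étale projective alteration `X' → X` of 4.15
for the modification `ψ` (4.4, `DeJong1996.ConclusionGenericallyEtale.of_isAlteration`), which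
preserves `dim X` (2.20, `IsAlteration.topologicalKrullDim_eq`). Together with the PROVED
remainder of 4.22 (`DeJong1996.StableModelMorphism.conclusionGenericallyEtale_of_preSemiStablePair`)
this gives `DeJong1996StableModelToPreSemiStablePair`
(`DeJong1996StableModelToPreSemiStablePair.of_stableModelToMorphism`). Users take
`(h : DeJong1996StableModelToMorphism)`; it is the node to decompose further (the three-point
lemma 4.18–4.21 with strict transforms 2.18 and flattening 2.19; 4.15 along a modification, with
the transport of (vi) f), g)). [cite: DeJong1996, 4.18–4.22, pp. 72–74] -/
def DeJong1996StableModelToMorphism : Prop :=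
  ∀ (k : Type u) [Field k] [IsAlgClosed k] (X Y : Scheme.{u}) [IsIntegral Y] (f : X ⟶ Y)
    [LocallyOfFinitePresentation f] (g : Y ⟶ Spec (.of k)) (Z : Set X),
    DeJong1996.FibredPair f g Z → DeJong1996.HasThreeSmoothPoints f Z →
      DeJong1996.IsUnionOfSectionsWithModel f g Z →
        (∀ (X' Y' C : Scheme.{u}) [IsIntegral Y'] (f' : X' ⟶ Y') [LocallyOfFinitePresentation f']
            (g' : Y' ⟶ Spec (.of k)) (Z' : Set X') (n : ℕ) (σ : Fin n → (Y' ⟶ X'))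
            (fC : C ⟶ Y') (τ : Fin n → (Y' ⟶ C)) (β : C ⟶ X'),
            DeJong1996.StableModelMorphism f' g' Z' σ fC τ β →
              topologicalKrullDim X' = topologicalKrullDim X →
                DeJong1996.ConclusionGenericallyEtale (f' ≫ g') Z') →
          DeJong1996.ConclusionGenericallyEtale (f ≫ g) Z

/-! ## The assembly -/

/-- **4.18–4.22a (`DeJong1996StableModelToPreSemiStablePair`) from 4.18–4.21 with the opening of
4.22 (`DeJong1996StableModelToMorphism`) and the PROVED remainder of 4.22
(`DeJong1996.StableModelMorphism.conclusionGenericallyEtale_of_preSemiStablePair`).**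
[cite: DeJong1996, 4.18–4.22, pp. 72–74] -/
theorem DeJong1996StableModelToPreSemiStablePair.of_stableModelToMorphism
    (h : DeJong1996StableModelToMorphism.{u}) : DeJong1996StableModelToPreSemiStablePair.{u} := by
  intro k _ _ X Y _ f _ g Z hP h3 hfg hS
  refine h k X Y f g Z hP h3 hfg ?_
  intro X' Y' C _ f' _ g' Z' n σ fC τ β hM hdim
  refine hM.conclusionGenericallyEtale_of_preSemiStablePair ?_
  intro X'' Y'' f'' g'' D'' n' τ' hpre hdim''
  exact hS X'' Y'' f'' g'' D'' n' τ' hpre (hdim''.trans hdim)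

/-- **4.17–4.22a (`DeJong1996SectionsToPreSemiStablePair`) from 4.17
(`DeJong1996StableModelReduction`) and 4.18–4.21 with the opening of 4.22
(`DeJong1996StableModelToMorphism`).** [cite: DeJong1996, 4.17–4.22, pp. 71–74] -/
theorem DeJong1996SectionsToPreSemiStablePair.of_stableModel_of_toMorphism
    (h₁ : DeJong1996StableModelReduction.{u}) (h₂ : DeJong1996StableModelToMorphism.{u}) :
    DeJong1996SectionsToPreSemiStablePair.{u} :=
  DeJong1996SectionsToPreSemiStablePair.of_stableModel_of_toPre h₁
    (DeJong1996StableModelToPreSemiStablePair.of_stableModelToMorphism h₂)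

/-- **4.15–4.22a (`DeJong1996MultisectionToPreSemiStablePair`) from 4.15–4.16
(`DeJong1996SectionsReduction`), 4.17 (`DeJong1996StableModelReduction`) and 4.18–4.21 with the
opening of 4.22 (`DeJong1996StableModelToMorphism`).** [cite: DeJong1996, 4.15–4.22, pp. 71–74] -/
theorem DeJong1996MultisectionToPreSemiStablePair.of_sections_of_stableModel_of_toMorphism
    (h₀ : DeJong1996SectionsReduction.{u}) (h₁ : DeJong1996StableModelReduction.{u})
    (h₂ : DeJong1996StableModelToMorphism.{u}) :
    DeJong1996MultisectionToPreSemiStablePair.{u} :=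
  DeJong1996MultisectionToPreSemiStablePair.of_sections_of_stableModel_of_toPre h₀ h₁
    (DeJong1996StableModelToPreSemiStablePair.of_stableModelToMorphism h₂)

/-- Sanity of the cut: `DeJong1996StableModelToMorphism` is a special case of Thm. 4.1 over
algebraically closed fields (a fibred pair is a pair as in Thm. 4.1). [folklore] -/
theorem DeJong1996StableModelToMorphism.of_strongAlgClosed (H : DeJong1996StrongAlgClosed.{u}) :
    DeJong1996StableModelToMorphism.{u} :=
  fun _ _ _ _ _ _ _ _ _ _ hP _ _ _ => hP.conclusionGenericallyEtale_of_strongAlgClosed H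

/-- **Thm. 4.1 with its generically-étale clause over algebraically closed fields
(`DeJong1996StrongAlgClosed`) from the seven live nodes** 4.11–4.12, 4.14, 4.15–4.16, 4.17,
4.18–4.21 with the opening of 4.22, 4.22b, 4.23–4.28 — the assembly
`DeJong1996StrongAlgClosed.of_sevenBlocks` with its node 4.18–4.22a served by
`DeJong1996StableModelToMorphism`. [cite: DeJong1996, 4.3–4.28, pp. 66–76] -/
theorem DeJong1996StrongAlgClosed.of_sevenBlocks_toMorphism (h₀ : DeJong1996FibrationReduction.{u})
    (h14 : DeJong1996MultisectionReduction.{u}) (hS : DeJong1996SectionsReduction.{u})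
    (h₁ : DeJong1996StableModelReduction.{u}) (h₂ : DeJong1996StableModelToMorphism.{u})
    (h₃ : DeJong1996PreSemiStablePairToSemiStablePair.{u})
    (hres : DeJong1996SemiStablePairResolution.{u}) : DeJong1996StrongAlgClosed.{u} :=
  DeJong1996StrongAlgClosed.of_sevenBlocks h₀ h14 hS h₁
    (DeJong1996StableModelToPreSemiStablePair.of_stableModelToMorphism h₂) h₃ hres

/-- Thm. 4.1 (i)+(ii) over every field from 4.5 (`DeJong1996Descent`) and the seven live nodes,
with 4.18–4.22a served by `DeJong1996StableModelToMorphism`. [cite: DeJong1996, 4.3–4.28, pp. 66–76] -/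
theorem DeJong1996Strong.of_descent_of_sevenBlocks_toMorphism (h45 : DeJong1996Descent.{u})
    (h₀ : DeJong1996FibrationReduction.{u}) (h14 : DeJong1996MultisectionReduction.{u})
    (hS : DeJong1996SectionsReduction.{u}) (h₁ : DeJong1996StableModelReduction.{u})
    (h₂ : DeJong1996StableModelToMorphism.{u})
    (h₃ : DeJong1996PreSemiStablePairToSemiStablePair.{u})
    (hres : DeJong1996SemiStablePairResolution.{u}) : DeJong1996Strong.{u} :=
  DeJong1996Strong.of_descent_of_sevenBlocks h45 h₀ h14 hS h₁
    (DeJong1996StableModelToPreSemiStablePair.of_stableModelToMorphism h₂) h₃ hres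

end Literature.AlgebraicGeometry.Resolution

end
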